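import Summits.AtomisticToContinuum.FouriersLaw.Theorems.LatticeLandauDampingAbelThermodynamicLimitOffsetMatchingOfEnginesSeveredLimit
import Summits.AtomisticToContinuum.FouriersLaw.Theorems.LatticeLandauDampingAbelThermodynamicLimitOffsetMatchingOfEnginesWindow
import Summits.AtomisticToContinuum.FouriersLaw.Theorems.LatticeLandauDampingAbelThermodynamicLimitOffsetMatchingOfEnginesTruncation
import Summits.AtomisticToContinuum.FouriersLaw.Theorems.LatticeLandauDampingAbelThermodynamicLimitBulkWindowEquivalence
import Summits.AtomisticToContinuum.FouriersLaw.Theorems.LatticeLandauDampingAbelThermodynamicLimitOpenChainSeveredLocality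
import Literature.MathematicalPhysics.KineticTheory.InfiniteChainL2LocalityTools

/-!
# Stubs (B′|E1,M1sev) `stub_uniformFixedTimeOffsetMatchingOfEngines` and (B′) `stub_uniformFixedTimeOffsetMatching` — PROVED
(crux `LatticeLandauDamping.AbelThermodynamicLimit`, item stmt-AtomisticToContinuum-14013, `Iff.rfl`-twin of stmt-12596; line
`series-law-at-every-laplace-frequency` (SketchIdeator2), lead's skeleton rev 7; `--supports` file, closes nothing)

For `P = pinnedChain ω₂ lam β γ` (all `> 0`), `T > 0` and a regular witness `(μT, D)` (DLR + shift-invariant + BM-superstable state;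
`D.carrier ⊆ bmGood`, `D` preserves `μT`, absolutely convergent correlations), the anchor-uniform per-offset fixed-time matching (B′)
`|⟨j_i(0) j_{i+x}(t)⟩_{N,T} − ∫ j_0 · (j_x ∘ φ_t) dμT| ≤ ε` (`N ≥ N₀`, all `L`-deep anchors `i`) follows from the two LANDED engines
(E1) `stub_bulkWindowEquivalence` (anchor-uniform bulk equivalence of ensembles on bounded measurable window observables) and (M1sev)
`stub_openChainSeveredLocality` (`N`-uniform `L²` locality of the OPEN chain, `P_t j_k ≈ j_k ∘ T^{[k-M,k+1+M]}_t ∘ ι_N`), in five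
`ε/8`-steps: (1) (M1sev) + Cauchy–Schwarz against the `N`-uniform `L²` norm of `j_i`; (2) two-level truncation of the product on the open
chain (fourth moments of `j_i`, only SECOND moments of the severed factor — part 3); (3) (E1) on the ONE window observable of part 2
(shift invariance of `μT` moves `boxPhaseAt (-a)` to `0`); (4) the severed bond windows recover `D.flow` under `μT` on the clamped pairing
(part 1; this fixes the margin `M`); (5) untruncation under `μT` (`L⁴(μT)` currents, invariance). The regular-DLR uniqueness clause is
carried, not used. `stub_uniformFixedTimeOffsetMatching` (B′) is then the coupling applied to the two landed engines, verbatim as in the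
skeleton. All statements proved; `[folklore]`. No definitions.
-/


noncomputable section

namespace Summit.AtomisticToContinuum.FouriersLaw.Theorems.AbelThermodynamicLimit.SeriesLawAtEveryLaplaceFrequency

open MeasureTheory ProbabilityTheory Set Filter Topology Function
open scoped NNReal ENNReal
open Literature.MathematicalPhysics.KineticTheory Literature.MathematicalPhysics.KineticTheory.HeatConduction
open OscillatorChain
open Literature.Analysis.FunctionSpaces (abs_max_neg_min_le)
open Summit.AtomisticToContinuum.FouriersLaw.Theorems.NonBallistic (pinnedChain_contactCurrentFourthMoment)
open Summit.AtomisticToContinuum.FouriersLaw.Theorems.SubdiffusiveBondHeat (pinnedChain_integral_sq_act_le)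
open Summit.AtomisticToContinuum.FouriersLaw.Theorems.LightConeBondHeat (pinnedChain_abs_bondCurrent_le_exp
  quarter_inv_temp_admissible)
open Summit.AtomisticToContinuum.FouriersLaw.Theorems.AbelThermodynamicLimit.LoomisCompactHorizonWitness
  (continuous_clamp pinnedChain_integral_sq_bondCurrent_gibbsMeasure_le)
namespace OffsetMatching

/-- `∫ w² ≤ 2 ∫ v² + 2 ∫ (v - w)²` (`w = v - (v - w)`). [folklore] -/
theorem integral_sq_le_two_mul_add {Ω : Type*} [MeasurableSpace Ω] (ρ : Measure Ω) {v w : Ω → ℝ}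
    (hv2 : Integrable (fun q => v q ^ 2) ρ) (hvw2 : Integrable (fun q => (v q - w q) ^ 2) ρ)
    (hw2 : Integrable (fun q => w q ^ 2) ρ) :
    ∫ q, w q ^ 2 ∂ρ ≤ 2 * (∫ q, v q ^ 2 ∂ρ) + 2 * ∫ q, (v q - w q) ^ 2 ∂ρ := by
  have hpt : ∀ q, w q ^ 2 ≤ 2 * v q ^ 2 + 2 * (v q - w q) ^ 2 := fun q => by
    nlinarith [sq_nonneg (2 * v q - w q)]
  calc ∫ q, w q ^ 2 ∂ρ ≤ ∫ q, (2 * v q ^ 2 + 2 * (v q - w q) ^ 2) ∂ρ :=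
        integral_mono hw2 ((hv2.const_mul 2).add (hvw2.const_mul 2)) hpt
    _ = 2 * (∫ q, v q ^ 2 ∂ρ) + 2 * ∫ q, (v q - w q) ^ 2 ∂ρ := by
        rw [integral_add (hv2.const_mul 2) (hvw2.const_mul 2), integral_const_mul, integral_const_mul]

/-- The embedding `ι_N z = (y ↦ (q_y, p_y) for 0 ≤ y < N, (0,0) otherwise)` of the stub's signature is measurable. [folklore] -/
theorem measurable_diteEmbed (N : ℕ) :
    Measurable fun (z : PhaseSpace N) (y : ℤ) =>
      if h : 0 ≤ y ∧ y < N then (z.1 ⟨y.toNat, by omega⟩, z.2 ⟨y.toNat, by omega⟩) else ((0 : ℝ), (0 : ℝ)) := by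
  refine measurable_pi_lambda _ fun y => ?_
  by_cases h : 0 ≤ y ∧ y < N
  · simp only [dif_pos h]
    exact ((measurable_pi_apply _).comp measurable_fst).prodMk ((measurable_pi_apply _).comp measurable_snd)
  · simp only [dif_neg h]
    exact measurable_const

end OffsetMatching

open OffsetMatching

/-- **Registered stub (B′|E1,M1sev) `stub_uniformFixedTimeOffsetMatchingOfEngines` of line
`series-law-at-every-laplace-frequency` — the two-dynamics coupling, PROVED** (see the module docstring for the five
steps): the static engine (E1) `stub_bulkWindowEquivalence` and the dynamical engine (M1sev) `stub_openChainSeveredLocality`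
imply the anchor-uniform per-offset fixed-time open/closed matching (B′) for every regular witness. [folklore] -/
theorem stub_uniformFixedTimeOffsetMatchingOfEngines :
    (∀ ω₂ lam β γ : ℝ, 0 < ω₂ → 0 < lam → 0 < β → 0 < γ → ∀ T : ℝ, 0 < T →
      ∀ μT : MeasureTheory.Measure Literature.MathematicalPhysics.KineticTheory.HeatConduction.ChainConfig,
        (Literature.MathematicalPhysics.KineticTheory.HeatConduction.pinnedChain ω₂ lam β γ).IsChainGibbsMeasure T μT →
        Literature.MathematicalPhysics.KineticTheory.HeatConduction.IsShiftInvariant μT →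
        (Literature.MathematicalPhysics.KineticTheory.HeatConduction.pinnedChain ω₂ lam β γ).HasSuperstabilityEstimate μT →
        ∀ (m : ℕ) (f : Literature.MathematicalPhysics.KineticTheory.HeatConduction.PhaseSpace (m + 1) → ℝ),
          Measurable f → (∀ w, |f w| ≤ 1) →
          ∀ ε : ℝ, 0 < ε → ∃ L N₀ : ℕ, ∀ N : ℕ, N₀ ≤ N → ∀ (i : Fin N) (hL : L ≤ i.val) (hi : i.val + m + L < N),
            |(∫ z, f (fun j : Fin (m + 1) => z.1 ⟨i.val + j.val, by omega⟩,
                      fun j : Fin (m + 1) => z.2 ⟨i.val + j.val, by omega⟩)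
                ∂((Literature.MathematicalPhysics.KineticTheory.HeatConduction.pinnedChain ω₂ lam β γ).gibbsMeasure N T)) -
              ∫ σ, f (Literature.MathematicalPhysics.KineticTheory.HeatConduction.boxPhaseAt 0 m σ) ∂μT| ≤ ε) →
    (∀ ω₂ lam β γ : ℝ, ∀ (hω : 0 < ω₂) (hl : 0 < lam) (hβ : 0 < β), 0 < γ → ∀ T : ℝ, 0 < T →
      ∀ τ : ℝ, 0 < τ → ∀ ε : ℝ, 0 < ε → ∃ M₀ : ℕ, ∀ M : ℕ, M₀ ≤ M → ∃ N₀ : ℕ, ∀ N : ℕ, N₀ ≤ N →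
        ∀ (k : Fin N) (hk : M + 2 ≤ k.val) (hkN : k.val + M + 3 < N), ∀ t ∈ Set.Icc (0 : ℝ) τ,
          MeasureTheory.Integrable (fun z : Literature.MathematicalPhysics.KineticTheory.HeatConduction.PhaseSpace N =>
              ((∫ y, (Literature.MathematicalPhysics.KineticTheory.HeatConduction.pinnedChain ω₂ lam β γ).bondCurrent N k y
                  ∂((Literature.MathematicalPhysics.KineticTheory.HeatConduction.pinnedChain ω₂ lam β γ).transitionKernel N T T t.toNNReal z)) -
                (Literature.MathematicalPhysics.KineticTheory.HeatConduction.pinnedChain ω₂ lam β γ).bondCurrentZ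
                  (Literature.MathematicalPhysics.KineticTheory.HeatConduction.OscillatorChain.severedFlow
                    (Literature.MathematicalPhysics.KineticTheory.HeatConduction.OscillatorChain.condB1_pinnedChain hω.le hl.le hβ.le γ)
                    (Finset.Icc ((k.val : ℤ) - M) ((k.val : ℤ) + 1 + M)) t
                    (fun x : ℤ => if h : 0 ≤ x ∧ x < N then (z.1 ⟨x.toNat, by omega⟩, z.2 ⟨x.toNat, by omega⟩) else (0, 0)))
                  (k.val : ℤ)) ^ 2)
            ((Literature.MathematicalPhysics.KineticTheory.HeatConduction.pinnedChain ω₂ lam β γ).gibbsMeasure N T) ∧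
          ∫ z : Literature.MathematicalPhysics.KineticTheory.HeatConduction.PhaseSpace N,
              ((∫ y, (Literature.MathematicalPhysics.KineticTheory.HeatConduction.pinnedChain ω₂ lam β γ).bondCurrent N k y
                  ∂((Literature.MathematicalPhysics.KineticTheory.HeatConduction.pinnedChain ω₂ lam β γ).transitionKernel N T T t.toNNReal z)) -
                (Literature.MathematicalPhysics.KineticTheory.HeatConduction.pinnedChain ω₂ lam β γ).bondCurrentZ
                  (Literature.MathematicalPhysics.KineticTheory.HeatConduction.OscillatorChain.severedFlow
                    (Literature.MathematicalPhysics.KineticTheory.HeatConduction.OscillatorChain.condB1_pinnedChain hω.le hl.le hβ.le γ)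
                    (Finset.Icc ((k.val : ℤ) - M) ((k.val : ℤ) + 1 + M)) t
                    (fun x : ℤ => if h : 0 ≤ x ∧ x < N then (z.1 ⟨x.toNat, by omega⟩, z.2 ⟨x.toNat, by omega⟩) else (0, 0)))
                  (k.val : ℤ)) ^ 2
            ∂((Literature.MathematicalPhysics.KineticTheory.HeatConduction.pinnedChain ω₂ lam β γ).gibbsMeasure N T) ≤ ε) →
∀ ω₂ lam β γ : ℝ, 0 < ω₂ → 0 < lam → 0 < β → 0 < γ → ∀ T : ℝ, 0 < T →
      (∀ μ₁ μ₂ : MeasureTheory.Measure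
            Literature.MathematicalPhysics.KineticTheory.HeatConduction.ChainConfig,
          (Literature.MathematicalPhysics.KineticTheory.HeatConduction.pinnedChain
                ω₂ lam β γ).IsChainGibbsMeasure T μ₁ →
          Literature.MathematicalPhysics.KineticTheory.HeatConduction.IsShiftInvariant μ₁ →
          (Literature.MathematicalPhysics.KineticTheory.HeatConduction.pinnedChain
                ω₂ lam β γ).HasSuperstabilityEstimate μ₁ →
          (Literature.MathematicalPhysics.KineticTheory.HeatConduction.pinnedChain
                ω₂ lam β γ).IsChainGibbsMeasure T μ₂ →
          Literature.MathematicalPhysics.KineticTheory.HeatConduction.IsShiftInvariant μ₂ →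
          (Literature.MathematicalPhysics.KineticTheory.HeatConduction.pinnedChain
                ω₂ lam β γ).HasSuperstabilityEstimate μ₂ → μ₁ = μ₂) →
      ∀ (μT : MeasureTheory.Measure
            Literature.MathematicalPhysics.KineticTheory.HeatConduction.ChainConfig)
        (D : Literature.MathematicalPhysics.KineticTheory.HeatConduction.InfiniteChainDynamics
          (Literature.MathematicalPhysics.KineticTheory.HeatConduction.pinnedChain ω₂ lam β γ)),
        (Literature.MathematicalPhysics.KineticTheory.HeatConduction.pinnedChain
            ω₂ lam β γ).IsChainGibbsMeasure T μT →
        Literature.MathematicalPhysics.KineticTheory.HeatConduction.IsShiftInvariant μT →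
        (Literature.MathematicalPhysics.KineticTheory.HeatConduction.pinnedChain
            ω₂ lam β γ).HasSuperstabilityEstimate μT →
        D.carrier ⊆ (Literature.MathematicalPhysics.KineticTheory.HeatConduction.pinnedChain
            ω₂ lam β γ).bmGood →
        D.PreservesMeasure μT →
        (∀ t : ℝ, D.HasAbsConvergentCorrelation μT t) →
        ∀ (x : ℤ) (t : ℝ), 0 < t → ∀ ε : ℝ, 0 < ε → ∃ L N₀ : ℕ, ∀ N : ℕ, N₀ ≤ N → ∀ i k : Fin N,
          L ≤ i.val → i.val + L < N → (k.val : ℤ) = i.val + x →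
          |(∫ z, (Literature.MathematicalPhysics.KineticTheory.HeatConduction.pinnedChain
                    ω₂ lam β γ).bondCurrent N i z *
              (∫ y, (Literature.MathematicalPhysics.KineticTheory.HeatConduction.pinnedChain
                    ω₂ lam β γ).bondCurrent N k y
                ∂((Literature.MathematicalPhysics.KineticTheory.HeatConduction.pinnedChain
                    ω₂ lam β γ).transitionKernel N T T t.toNNReal z))
              ∂((Literature.MathematicalPhysics.KineticTheory.HeatConduction.pinnedChain
                    ω₂ lam β γ).gibbsMeasure N T)) -
            ∫ σ, (Literature.MathematicalPhysics.KineticTheory.HeatConduction.pinnedChain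
                    ω₂ lam β γ).bondCurrentZ σ 0 *
              (Literature.MathematicalPhysics.KineticTheory.HeatConduction.pinnedChain
                    ω₂ lam β γ).bondCurrentZ (D.flow t σ) x ∂μT| ≤ ε := by
  intro hE1 hM1 ω₂ lam β γ hω hl hβ hγ T hT _hU μT D hG hS hss hcar hPres hAC x t ht ε hε
  /- ### constants -/
  haveI hμT : IsProbabilityMeasure μT := hG.isProbabilityMeasure
  set hB1 : (pinnedChain ω₂ lam β γ).CondB1 := condB1_pinnedChain hω.le hl.le hβ.le γ with hB1def
  have hU2 : ContDiff ℝ 2 (pinnedChain ω₂ lam β γ).U := (pinnedChain_isEvenPolyOfDegree_U β γ hω.le hl).contDiff_two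
  have hV2 : ContDiff ℝ 2 (pinnedChain ω₂ lam β γ).V := (pinnedChain_isEvenPolyOfDegree_V ω₂ lam γ hβ).contDiff_two
  haveI hμN : ∀ N : ℕ, IsProbabilityMeasure ((pinnedChain ω₂ lam β γ).gibbsMeasure N T) := fun N =>
    pinnedChain_isProbabilityMeasure_gibbsMeasure hω hl.le hβ.le γ N hT
  obtain ⟨hϑ0, h2ϑ⟩ := quarter_inv_temp_admissible hT
  -- `N`-uniform second and fourth moments of the bond currents under `μ_{N,T}`
  obtain ⟨C₂, hC₂⟩ := pinnedChain_integral_sq_bondCurrent_gibbsMeasure_le (γ := γ) hω hl hβ hT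
  have hC₂0 : 0 ≤ C₂ := (integral_nonneg fun z => sq_nonneg _).trans (hC₂ 1 ⟨0, one_pos⟩)
  obtain ⟨C₄, hC₄0, hC₄⟩ := pinnedChain_contactCurrentFourthMoment ω₂ lam β γ hω hl.le hβ.le T hT
  -- moments under `μT`
  have hj4 : ∀ y : ℤ, Integrable (fun σ => (pinnedChain ω₂ lam β γ).bondCurrentZ σ y ^ 4) μT := by
    intro y
    have h := (memLp_bondCurrentZ_pinnedChain γ hω.le hl.le hβ hss y (p := ((4 : ℕ) : ℝ≥0∞))
      (by simp)).integrable_norm_pow'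
    refine h.congr (Eventually.of_forall fun σ => ?_)
    simp only [Real.norm_eq_abs, pow_abs]
    exact abs_of_nonneg (by positivity)
  have hj2 : ∀ y : ℤ, MemLp (fun σ => (pinnedChain ω₂ lam β γ).bondCurrentZ σ y) 2 μT := fun y =>
    memLp_bondCurrentZ_pinnedChain γ hω.le hl.le hβ hss y (by simp)
  set m₄ : ℝ := ∫ σ, (pinnedChain ω₂ lam β γ).bondCurrentZ σ 0 ^ 4 ∂μT with hm₄
  set m₂ : ℝ := ∫ σ, (pinnedChain ω₂ lam β γ).bondCurrentZ σ x ^ 2 ∂μT with hm₂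
  have hm₂0 : 0 ≤ m₂ := integral_nonneg fun σ => sq_nonneg _
  set C₂' : ℝ := 2 * C₂ + 2 with hC₂'
  have hC₂'0 : 0 ≤ C₂' := by rw [hC₂']; positivity
  /- ### tolerances -/
  obtain ⟨A, B, hA0, hB0, hABN, hABT⟩ := exists_truncation_levels C₄ m₄ hε hC₂'0 hm₂0
  obtain ⟨hεA0, hεA1, hεAC⟩ := sqrt_mul_sqrt_tolerance_le hC₂0 hε
  set εA : ℝ := min 1 ((ε / 8) ^ 2 / (C₂ + 1)) with hεA
  -- (M1sev) at horizon `t`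
  obtain ⟨M₀, hM₀⟩ := hM1 ω₂ lam β γ hω hl hβ hγ T hT t ht εA hεA0
  -- the severed bond windows recover `D.flow` on the clamped pairing (part 1)
  have hsev := tendsto_integral_clamp_bondCurrentZ_severedFlow_bondWindow hω hl hβ hB1 (μT := μT) D hcar hPres t x
    hA0.le hB0.le
  obtain ⟨M₁, hM₁⟩ := Metric.tendsto_atTop.1 hsev (ε / 8) (by positivity)
  -- fix the window margin `M`
  set M : ℕ := max M₀ M₁ with hMdef
  obtain ⟨NA, hNA⟩ := hM₀ M (le_max_left _ _)
  have h34 := hM₁ M (le_max_right _ _)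
  rw [Real.dist_eq] at h34
  -- the window observable (part 2)
  have hgAm : Measurable fun r : ℝ => max (-A) (min A r) / A := (continuous_clamp A).measurable.div_const A
  have hgBm : Measurable fun r : ℝ => max (-B) (min B r) / B := (continuous_clamp B).measurable.div_const B
  obtain ⟨a, hax⟩ : ∃ a : ℕ, (M : ℤ) + 1 - x ≤ a := ⟨(M + 1 - x).toNat, by omega⟩
  obtain ⟨b, hb1, hbx⟩ : ∃ b : ℕ, 1 ≤ b ∧ x + M + 2 ≤ (b : ℤ) := ⟨(x + M + 2).toNat + 1, by omega, by omega⟩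
  obtain ⟨f, hfm, hfrs, hfinf, hffin⟩ :=
    pinnedChain_windowObservable ω₂ lam β γ hω hl hβ hB1 _ _ hgAm hgBm x M t a b hax hb1 hbx
  have hfbd : ∀ w, |f w| ≤ 1 := by
    intro w
    obtain ⟨r, r', e⟩ := hfrs w
    rw [e, abs_mul]
    have h1 : |max (-A) (min A r) / A| ≤ 1 := by
      rw [abs_div, abs_of_pos hA0, div_le_one hA0]; exact abs_max_neg_min_le hA0.le r
    have h2 : |max (-B) (min B r') / B| ≤ 1 := by
      rw [abs_div, abs_of_pos hB0, div_le_one hB0]; exact abs_max_neg_min_le hB0.le r'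
    exact mul_le_one₀ h1 (abs_nonneg _) h2
  -- (E1) on the window observable
  have hAB : 0 < A * B := mul_pos hA0 hB0
  obtain ⟨LE, NE, hNE⟩ := hE1 ω₂ lam β γ hω hl hβ hγ T hT μT hG hS hss (a + b) f hfm hfbd (ε / 8 / (A * B))
    (by positivity)
  /- ### the thresholds -/
  refine ⟨LE + a + b + 2 * M + x.natAbs + 5, max (max NA NE) 1, fun N hN i k hLi hiL hk => ?_⟩
  have hNA' : NA ≤ N := le_trans (le_trans (le_max_left _ _) (le_max_left _ _)) hN
  have hNE' : NE ≤ N := le_trans (le_trans (le_max_right _ _) (le_max_left _ _)) hN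
  have hN0 : 0 < N := lt_of_lt_of_le one_pos (le_trans (le_max_right _ _) hN)
  have hai : a ≤ i.val := by omega
  have hib : i.val + b < N := by omega
  have hkM : M + 2 ≤ k.val := by omega
  have hkN : k.val + M + 3 < N := by omega
  set i₀ : Fin N := ⟨i.val - a, by omega⟩ with hi₀
  have h₀ : i₀.val + a = i.val := by show i.val - a + a = i.val; omega
  have hLE1 : LE ≤ i₀.val := by show LE ≤ i.val - a; omega
  have hLE2 : i₀.val + (a + b) + LE < N := by show i.val - a + (a + b) + LE < N; omega
  /- ### the objects on the open chain -/
  set μN := (pinnedChain ω₂ lam β γ).gibbsMeasure N T with hμNdef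
  set ι : PhaseSpace N → ChainConfig := fun z y =>
    if h : 0 ≤ y ∧ y < N then (z.1 ⟨y.toNat, by omega⟩, z.2 ⟨y.toNat, by omega⟩) else (0, 0) with hι
  have hιm : Measurable ι := measurable_diteEmbed N
  set u : PhaseSpace N → ℝ := fun z => (pinnedChain ω₂ lam β γ).bondCurrent N i z with hu
  set v : PhaseSpace N → ℝ := fun z => ∫ y, (pinnedChain ω₂ lam β γ).bondCurrent N k y
    ∂((pinnedChain ω₂ lam β γ).transitionKernel N T T t.toNNReal z) with hv
  set w : PhaseSpace N → ℝ := fun z => (pinnedChain ω₂ lam β γ).bondCurrentZ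
    (severedFlow hB1 (Finset.Icc ((k.val : ℤ) - M) ((k.val : ℤ) + 1 + M)) t (ι z)) (k.val : ℤ) with hw
  -- measurability
  have hum : Measurable u := (pinnedChain_continuous_bondCurrent ω₂ lam β γ N i).measurable
  have hvm : AEStronglyMeasurable v μN :=
    ((pinnedChain_continuous_bondCurrent ω₂ lam β γ N k).stronglyMeasurable.integral_kernel
      (κ := (pinnedChain ω₂ lam β γ).transitionKernel N T T t.toNNReal)).aestronglyMeasurable
  have hwm : Measurable w :=
    (measurable_bondCurrentZ _ _).comp ((measurable_severedFlow hB1 _ hU2 hV2 t).comp hιm)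
  -- square integrability
  have hsqi := pinnedChain_integral_sq_act_le hω hl.le hβ hγ hN0 hT hϑ0 h2ϑ
    (pinnedChain_continuous_bondCurrent ω₂ lam β γ N i) (pinnedChain_abs_bondCurrent_le_exp hω.le hl.le hβ.le γ N hϑ0 i)
    t.toNNReal
  have hsqk := pinnedChain_integral_sq_act_le hω hl.le hβ hγ hN0 hT hϑ0 h2ϑ
    (pinnedChain_continuous_bondCurrent ω₂ lam β γ N k) (pinnedChain_abs_bondCurrent_le_exp hω.le hl.le hβ.le γ N hϑ0 k)
    t.toNNReal
  have hu2 : MemLp u 2 μN := (memLp_two_iff_integrable_sq hum.aestronglyMeasurable).2 hsqi.1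
  have hv2int : Integrable (fun z => v z ^ 2) μN := hsqk.2.1
  have hv2 : MemLp v 2 μN := (memLp_two_iff_integrable_sq hvm).2 hv2int
  have hv2le : ∫ z, v z ^ 2 ∂μN ≤ C₂ := hsqk.2.2.trans (hC₂ N k)
  -- (M1sev) at `(M, N, k, t)`
  obtain ⟨hYint, hYle⟩ := hNA N hNA' k hkM hkN t ⟨ht.le, le_rfl⟩
  have hYint' : Integrable (fun z => (v z - w z) ^ 2) μN := hYint
  have hYle' : ∫ z, (v z - w z) ^ 2 ∂μN ≤ εA := hYle
  have hvw2 : MemLp (fun z => v z - w z) 2 μN := (memLp_two_iff_integrable_sq (hvm.sub hwm.aestronglyMeasurable)).2 hYint'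
  have hw2 : MemLp w 2 μN := (hv2.sub hvw2).ae_eq (Eventually.of_forall fun z => by simp)
  have hw2int : Integrable (fun z => w z ^ 2) μN := hw2.integrable_sq
  have hw2le : ∫ z, w z ^ 2 ∂μN ≤ C₂' :=
    calc ∫ z, w z ^ 2 ∂μN ≤ 2 * (∫ z, v z ^ 2 ∂μN) + 2 * ∫ z, (v z - w z) ^ 2 ∂μN :=
          integral_sq_le_two_mul_add μN hv2int hYint' hw2int
      _ ≤ 2 * C₂ + 2 * 1 := by gcongr; exact hYle'.trans hεA1
      _ = C₂' := by rw [hC₂']; ring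
  have huv : Integrable (fun z => u z * v z) μN := hu2.integrable_mul hv2
  have huw : Integrable (fun z => u z * w z) μN := hu2.integrable_mul hw2
  /- ### Step 1: (M1sev) + Cauchy–Schwarz -/
  have h01 : |(∫ z, u z * v z ∂μN) - ∫ z, u z * w z ∂μN| ≤ ε / 8 := by
    have e : (∫ z, u z * v z ∂μN) - ∫ z, u z * w z ∂μN = ∫ z, u z * (v z - w z) ∂μN := by
      rw [← integral_sub huv huw]
      exact integral_congr_ae (Eventually.of_forall fun z => by ring)
    rw [e]
    calc |∫ z, u z * (v z - w z) ∂μN| ≤ Real.sqrt (∫ z, u z ^ 2 ∂μN) * Real.sqrt (∫ z, (v z - w z) ^ 2 ∂μN) :=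
          abs_integral_mul_le_sqrt_integral_sq_mul hu2 hvw2
      _ ≤ Real.sqrt C₂ * Real.sqrt εA :=
          mul_le_mul (Real.sqrt_le_sqrt (hC₂ N i)) (Real.sqrt_le_sqrt hYle') (Real.sqrt_nonneg _)
            (Real.sqrt_nonneg _)
      _ ≤ ε / 8 := hεAC
  /- ### Step 2: two-level truncation on the open chain -/
  have h12 : |(∫ z, u z * w z ∂μN) - ∫ z, max (-A) (min A (u z)) * max (-B) (min B (w z)) ∂μN| ≤ ε / 8 := by
    refine (abs_integral_mul_sub_integral_clamp_two_le μN hum hwm huw (hC₄ N i).1 hw2int hA0 hB0).trans ?_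
    refine le_trans ?_ hABN
    have h1 : Real.sqrt (∫ z, u z ^ 4 ∂μN) ≤ Real.sqrt C₄ := Real.sqrt_le_sqrt (hC₄ N i).2
    have h2 : Real.sqrt (∫ z, w z ^ 2 ∂μN) ≤ Real.sqrt C₂' := Real.sqrt_le_sqrt hw2le
    exact add_le_add (div_le_div_of_nonneg_right (mul_le_mul h1 h2 (Real.sqrt_nonneg _) (Real.sqrt_nonneg _)) hA0.le)
      (div_le_div_of_nonneg_right (mul_le_mul_of_nonneg_left hw2le hA0.le) hB0.le)
  /- ### Step 3: (E1) on the window observable -/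
  have h23 : |(∫ z, max (-A) (min A (u z)) * max (-B) (min B (w z)) ∂μN) -
      ∫ σ, max (-A) (min A ((pinnedChain ω₂ lam β γ).bondCurrentZ σ 0)) *
        max (-B) (min B ((pinnedChain ω₂ lam β γ).bondCurrentZ
          (severedFlow hB1 (Finset.Icc (x - M) (x + 1 + M)) t σ) x)) ∂μT| ≤ ε / 8 := by
    have hE := hNE N hNE' i₀ hLE1 hLE2
    -- the open-chain integrand
    have e1 : ∫ z, f (fun j : Fin (a + b + 1) => z.1 ⟨i₀.val + j.val, by omega⟩,
        fun j : Fin (a + b + 1) => z.2 ⟨i₀.val + j.val, by omega⟩) ∂μN =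
        (∫ z, max (-A) (min A (u z)) * max (-B) (min B (w z)) ∂μN) / (A * B) := by
      rw [← integral_div]
      refine integral_congr_ae (Eventually.of_forall fun z => ?_)
      dsimp only
      rw [hffin N i₀ i k h₀ hib hk z]
      ring
    -- the infinite-chain integrand
    have e2 : ∫ σ, f (boxPhaseAt 0 (a + b) σ) ∂μT =
        (∫ σ, max (-A) (min A ((pinnedChain ω₂ lam β γ).bondCurrentZ σ 0)) *
          max (-B) (min B ((pinnedChain ω₂ lam β γ).bondCurrentZ
            (severedFlow hB1 (Finset.Icc (x - M) (x + 1 + M)) t σ) x)) ∂μT) / (A * B) := by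
      rw [hfinf μT hS, ← integral_div]
      refine integral_congr_ae (Eventually.of_forall fun σ => ?_)
      dsimp only
      ring
    rw [e1, e2, ← sub_div, abs_div, abs_of_pos hAB, div_le_div_iff_of_pos_right hAB] at hE
    exact hE
  /- ### Step 5: untruncation under `μT` -/
  have h45 : |(∫ σ, max (-A) (min A ((pinnedChain ω₂ lam β γ).bondCurrentZ σ 0)) *
        max (-B) (min B ((pinnedChain ω₂ lam β γ).bondCurrentZ (D.flow t σ) x)) ∂μT) -
      ∫ σ, (pinnedChain ω₂ lam β γ).bondCurrentZ σ 0 * (pinnedChain ω₂ lam β γ).bondCurrentZ (D.flow t σ) x ∂μT| ≤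
      ε / 8 := by
    rw [abs_sub_comm]
    have hwm' : Measurable fun σ => (pinnedChain ω₂ lam β γ).bondCurrentZ (D.flow t σ) x :=
      (measurable_bondCurrentZ _ x).comp (hPres.2 t).measurable
    have hw2' : Integrable (fun σ => (pinnedChain ω₂ lam β γ).bondCurrentZ (D.flow t σ) x ^ 2) μT :=
      ((hj2 x).comp_measurePreserving (hPres.2 t)).integrable_sq
    have ew : ∫ σ, (pinnedChain ω₂ lam β γ).bondCurrentZ (D.flow t σ) x ^ 2 ∂μT = m₂ :=
      integral_sq_comp_eq' (hPres.2 t) (measurable_bondCurrentZ _ x)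
    refine (abs_integral_mul_sub_integral_clamp_two_le μT (measurable_bondCurrentZ _ 0) hwm' ((hAC t).1 x) (hj4 0)
      hw2' hA0 hB0).trans ?_
    rw [ew]
    exact hABT
  /- ### assembly -/
  have t1 := abs_sub_le (∫ z, u z * v z ∂μN) (∫ z, u z * w z ∂μN)
    (∫ σ, (pinnedChain ω₂ lam β γ).bondCurrentZ σ 0 * (pinnedChain ω₂ lam β γ).bondCurrentZ (D.flow t σ) x ∂μT)
  have t2 := abs_sub_le (∫ z, u z * w z ∂μN) (∫ z, max (-A) (min A (u z)) * max (-B) (min B (w z)) ∂μN)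
    (∫ σ, (pinnedChain ω₂ lam β γ).bondCurrentZ σ 0 * (pinnedChain ω₂ lam β γ).bondCurrentZ (D.flow t σ) x ∂μT)
  have t3 := abs_sub_le (∫ z, max (-A) (min A (u z)) * max (-B) (min B (w z)) ∂μN)
    (∫ σ, max (-A) (min A ((pinnedChain ω₂ lam β γ).bondCurrentZ σ 0)) *
      max (-B) (min B ((pinnedChain ω₂ lam β γ).bondCurrentZ
        (severedFlow hB1 (Finset.Icc (x - M) (x + 1 + M)) t σ) x)) ∂μT)
    (∫ σ, (pinnedChain ω₂ lam β γ).bondCurrentZ σ 0 * (pinnedChain ω₂ lam β γ).bondCurrentZ (D.flow t σ) x ∂μT)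
  have t4 := abs_sub_le (∫ σ, max (-A) (min A ((pinnedChain ω₂ lam β γ).bondCurrentZ σ 0)) *
      max (-B) (min B ((pinnedChain ω₂ lam β γ).bondCurrentZ
        (severedFlow hB1 (Finset.Icc (x - M) (x + 1 + M)) t σ) x)) ∂μT)
    (∫ σ, max (-A) (min A ((pinnedChain ω₂ lam β γ).bondCurrentZ σ 0)) *
      max (-B) (min B ((pinnedChain ω₂ lam β γ).bondCurrentZ (D.flow t σ) x)) ∂μT)
    (∫ σ, (pinnedChain ω₂ lam β γ).bondCurrentZ σ 0 * (pinnedChain ω₂ lam β γ).bondCurrentZ (D.flow t σ) x ∂μT)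
  show |(∫ z, u z * v z ∂μN) -
    ∫ σ, (pinnedChain ω₂ lam β γ).bondCurrentZ σ 0 * (pinnedChain ω₂ lam β γ).bondCurrentZ (D.flow t σ) x ∂μT| ≤ ε
  linarith

/-- **Registered stub (B′) `stub_uniformFixedTimeOffsetMatching` of line `series-law-at-every-laplace-frequency` — PROVED**: per-offset
fixed-time open/closed matching, anchor-uniform form, for every regular witness; the coupling `stub_uniformFixedTimeOffsetMatchingOfEngines`
applied to the landed engines (E1) `stub_bulkWindowEquivalence` and (M1sev) `stub_openChainSeveredLocality`. [folklore] -/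
theorem stub_uniformFixedTimeOffsetMatching :
∀ ω₂ lam β γ : ℝ, 0 < ω₂ → 0 < lam → 0 < β → 0 < γ → ∀ T : ℝ, 0 < T →
      (∀ μ₁ μ₂ : MeasureTheory.Measure
            Literature.MathematicalPhysics.KineticTheory.HeatConduction.ChainConfig,
          (Literature.MathematicalPhysics.KineticTheory.HeatConduction.pinnedChain
                ω₂ lam β γ).IsChainGibbsMeasure T μ₁ →
          Literature.MathematicalPhysics.KineticTheory.HeatConduction.IsShiftInvariant μ₁ →
          (Literature.MathematicalPhysics.KineticTheory.HeatConduction.pinnedChain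
                ω₂ lam β γ).HasSuperstabilityEstimate μ₁ →
          (Literature.MathematicalPhysics.KineticTheory.HeatConduction.pinnedChain
                ω₂ lam β γ).IsChainGibbsMeasure T μ₂ →
          Literature.MathematicalPhysics.KineticTheory.HeatConduction.IsShiftInvariant μ₂ →
          (Literature.MathematicalPhysics.KineticTheory.HeatConduction.pinnedChain
                ω₂ lam β γ).HasSuperstabilityEstimate μ₂ → μ₁ = μ₂) →
      ∀ (μT : MeasureTheory.Measure
            Literature.MathematicalPhysics.KineticTheory.HeatConduction.ChainConfig)
        (D : Literature.MathematicalPhysics.KineticTheory.HeatConduction.InfiniteChainDynamics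
          (Literature.MathematicalPhysics.KineticTheory.HeatConduction.pinnedChain ω₂ lam β γ)),
        (Literature.MathematicalPhysics.KineticTheory.HeatConduction.pinnedChain
            ω₂ lam β γ).IsChainGibbsMeasure T μT →
        Literature.MathematicalPhysics.KineticTheory.HeatConduction.IsShiftInvariant μT →
        (Literature.MathematicalPhysics.KineticTheory.HeatConduction.pinnedChain
            ω₂ lam β γ).HasSuperstabilityEstimate μT →
        D.carrier ⊆ (Literature.MathematicalPhysics.KineticTheory.HeatConduction.pinnedChain
            ω₂ lam β γ).bmGood →
        D.PreservesMeasure μT →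
        (∀ t : ℝ, D.HasAbsConvergentCorrelation μT t) →
        ∀ (x : ℤ) (t : ℝ), 0 < t → ∀ ε : ℝ, 0 < ε → ∃ L N₀ : ℕ, ∀ N : ℕ, N₀ ≤ N → ∀ i k : Fin N,
          L ≤ i.val → i.val + L < N → (k.val : ℤ) = i.val + x →
          |(∫ z, (Literature.MathematicalPhysics.KineticTheory.HeatConduction.pinnedChain
                    ω₂ lam β γ).bondCurrent N i z *
              (∫ y, (Literature.MathematicalPhysics.KineticTheory.HeatConduction.pinnedChain
                    ω₂ lam β γ).bondCurrent N k y
                ∂((Literature.MathematicalPhysics.KineticTheory.HeatConduction.pinnedChain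
                    ω₂ lam β γ).transitionKernel N T T t.toNNReal z))
              ∂((Literature.MathematicalPhysics.KineticTheory.HeatConduction.pinnedChain
                    ω₂ lam β γ).gibbsMeasure N T)) -
            ∫ σ, (Literature.MathematicalPhysics.KineticTheory.HeatConduction.pinnedChain
                    ω₂ lam β γ).bondCurrentZ σ 0 *
              (Literature.MathematicalPhysics.KineticTheory.HeatConduction.pinnedChain
                    ω₂ lam β γ).bondCurrentZ (D.flow t σ) x ∂μT| ≤ ε :=
  stub_uniformFixedTimeOffsetMatchingOfEngines stub_bulkWindowEquivalence stub_openChainSeveredLocality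

end Summit.AtomisticToContinuum.FouriersLaw.Theorems.AbelThermodynamicLimit.SeriesLawAtEveryLaplaceFrequency

end
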